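import Mathlib.Topology.Connected.LocallyPathConnected
import Literature.Topology.PlaneTopology.UniformLocalConnectedness
import Literature.Topology.PlaneTopology.JordanCurveProofs
import HarnessLib

/-!
# The exterior of a Jordan domain is uniformly locally connected (Newman, Thm. VI.14·1)

Topic: Probability / RandomPlanarGeometry (facts about `JordanDomain`, companion to
`Topology/PlaneTopology/UniformLocalConnectedness.lean`). M. H. A. Newman, *Elements of the
topology of plane sets of points* (Cambridge, 1939), Ch. VI §14, **Theorem 14·1** (p. 161): "*All
Jordan domains are ulc*" — i.e. *both* residual domains of a Jordan curve are uniformly locally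
connected. `UniformLocalConnectedness.lean` proves this for the bounded residual domain
`D.carrier` of an `JordanDomain` `D`; this file proves it, by the same argument of Newman
(Janiszewski's theorem V.9·2), for the **exterior** `(closure D.carrier)ᶜ`, now unconditionally
(the Jordan curve theorem `JordanCurveTheorem_holds` is a theorem of the tree):

* `exterior_uniformlyLocallyConnected`: for `ε > 0` there is `η > 0` such that two exterior
  points at distance `< η` lie in a connected subset of the exterior inside the `ε`-ball about
  the first point;
* `exterior_joinedIn_of_dist_lt`: the same with a *path* in `(closure D)ᶜ ∩ ball x ε` (open
  connected subsets of the plane are path connected).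

This is the plane-topology input of the theorem "the largest mesh component of a Jordan domain
is the bulk" (`Probability/LatticeModels/MeshDomainJordan.lean`): short exterior detours close
up the small loops that rule out macroscopic stray mesh components.

Mathlib anchors: `IsOpen.isConnected_iff_isPathConnected`, `connectedComponentIn`, `JoinedIn`,
`IsPreconnected.subset_or_subset`. H21 anchors: `JordanDomain.exterior_of_JCT`
(`PlanarDomainsTopology.lean`), `JordanDomain.exists_forall_dist_boundary_lt`,
`JordanDomain.exists_pos_le_dist_boundary`, `JordanDomain.subset_ball_of_isPreconnected`
(`UniformLocalConnectedness.lean`), `janiszewski'` (`Janiszewski.lean`).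

## References
* M. H. A. Newman, *Elements of the topology of plane sets of points*, Cambridge Univ. Press
  (1939), Ch. VI §14 Thm. 14·1 p. 161. [Newman1939]
-/

namespace Literature.Probability.RandomPlanarGeometry.JordanDomain

open Set Metric _root_.Topology

variable (D : JordanDomain)

/-! ### The exterior domain -/

/-- The exterior `(closure D)ᶜ` of a Jordan domain is open. [folklore] -/
theorem isOpen_exterior : IsOpen (closure D.carrier)ᶜ :=
  isClosed_closure.isOpen_compl

/-- The exterior of a Jordan domain is connected (Jordan curve theorem). [folklore] -/
theorem isConnected_exterior : IsConnected (closure D.carrier)ᶜ :=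
  (D.exterior_of_JCT Literature.Topology.PlaneTopology.JordanCurveTheorem_holds).1

/-- The exterior of a Jordan domain has the boundary curve as its frontier (Jordan curve
theorem). [folklore] -/
theorem frontier_exterior : frontier (closure D.carrier)ᶜ = frontier D.carrier :=
  (D.exterior_of_JCT Literature.Topology.PlaneTopology.JordanCurveTheorem_holds).2.1

/-- The exterior does not meet the boundary curve. [folklore] -/
theorem disjoint_exterior_frontier : Disjoint (closure D.carrier)ᶜ (frontier D.carrier) :=
  Set.disjoint_left.2 fun _ hz hzf => hz (frontier_subset_closure hzf)

/-- The exterior does not meet the domain. [folklore] -/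
theorem disjoint_carrier_exterior : Disjoint D.carrier (closure D.carrier)ᶜ :=
  disjoint_compl_right.mono_left subset_closure

/-- The plane is the disjoint union of the domain, its boundary curve and the exterior: a point
off the curve and off the domain is exterior. [folklore] -/
theorem mem_exterior_of_not_mem {z : ℂ} (hz : z ∉ D.carrier) (hzf : z ∉ frontier D.carrier) :
    z ∈ (closure D.carrier)ᶜ := by
  rw [mem_compl_iff, closure_eq_self_union_frontier]
  rintro (h | h)
  · exact hz h
  · exact hzf h

/-- Every boundary point of a Jordan domain is a limit of exterior points. [folklore] -/
theorem frontier_subset_closure_exterior' : frontier D.carrier ⊆ closure (closure D.carrier)ᶜ :=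
  D.frontier_subset_closure_exterior Literature.Topology.PlaneTopology.JordanCurveTheorem_holds

/-- A preconnected set missing the boundary curve and meeting the exterior lies in the exterior
(the domain and the exterior are disjoint open sets covering the complement of the curve).
[folklore] -/
theorem subset_exterior_of_isPreconnected {S : Set ℂ} (hS : IsPreconnected S)
    (hSf : Disjoint S (frontier D.carrier)) (hx : (S ∩ (closure D.carrier)ᶜ).Nonempty) :
    S ⊆ (closure D.carrier)ᶜ := by
  have hcover : S ⊆ D.carrier ∪ (closure D.carrier)ᶜ := by
    intro z hz
    by_cases hzD : z ∈ D.carrier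
    · exact Or.inl hzD
    · exact Or.inr (D.mem_exterior_of_not_mem hzD fun h => Set.disjoint_left.1 hSf hz h)
  rcases hS.subset_or_subset D.isOpen D.isOpen_exterior D.disjoint_carrier_exterior hcover
    with h | h
  · obtain ⟨z, hzS, hzE⟩ := hx
    exact absurd (subset_closure (h hzS)) hzE
  · exact h

/-! ### Newman's Theorem VI.14·1 for the exterior -/

/-- **The exterior of a Jordan domain is uniformly locally connected** (Newman 1939, Ch. VI,
Thm. 14·1, p. 161, "all Jordan domains are ulc", applied to the unbounded residual domain): for
every `ε > 0` there is `η > 0` such that any two exterior points at distance `< η` lie in a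
connected subset of the exterior contained in the ball of radius `ε` about the first point.
Proof: Newman's (as in `JordanDomain.uniformlyLocallyConnected`): if no boundary point is within
`η` of `x` the segment `[x, y]` works; otherwise, with `a` a nearby boundary point, `L₂` the arc
of the curve with parameters `τ`-away from that of `a`, `x, y` are separated neither by the
curve (both exterior) nor by `sphere a (ε/2) ∪ L₂` (the segment), whose intersection with the
curve is the continuum `L₂`; by Janiszewski they lie in a continuum missing both, which is then
inside the exterior and inside the sphere. [cite: Newman1939, Ch. VI §14 Thm. 14·1 p. 161] -/
theorem exterior_uniformlyLocallyConnected {ε : ℝ} (hε : 0 < ε) :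
    ∃ η > 0, ∀ x ∈ (closure D.carrier)ᶜ, ∀ y ∈ (closure D.carrier)ᶜ, dist x y < η →
      ∃ S ⊆ (closure D.carrier)ᶜ ∩ ball x ε, IsPreconnected S ∧ x ∈ S ∧ y ∈ S := by
  obtain ⟨τ, hτ, hτ1, hτε⟩ := D.exists_forall_dist_boundary_lt (half_pos hε)
  obtain ⟨m, hm, hmsep⟩ := D.exists_pos_le_dist_boundary hτ hτ1
  refine ⟨min (m / 2) (ε / 8), lt_min (by positivity) (by positivity), fun x hx y hy hxy => ?_⟩
  have hηm : min (m / 2) (ε / 8) ≤ m / 2 := min_le_left _ _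
  have hηε : min (m / 2) (ε / 8) ≤ ε / 8 := min_le_right _ _
  set η := min (m / 2) (ε / 8) with hη
  have hseg : segment ℝ x y ⊆ ball x η :=
    (convex_ball x η).segment_subset (mem_ball_self (lt_min (by positivity) (by positivity)))
      (mem_ball_comm.1 hxy)
  by_cases hfar : ∀ a ∈ frontier D.carrier, η ≤ dist x a
  · -- Case A: no boundary point near `x`; the segment itself works
    refine ⟨segment ℝ x y, fun z hz => ⟨?_, ?_⟩, (convex_segment x y).isPreconnected,
      left_mem_segment ℝ x y, right_mem_segment ℝ x y⟩
    · refine D.subset_exterior_of_isPreconnected (convex_segment x y).isPreconnected ?_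
        ⟨x, left_mem_segment ℝ x y, hx⟩ hz
      rw [Set.disjoint_left]
      intro w hw hwf
      have h1 := hfar w hwf
      have h2 : dist w x < η := hseg hw
      rw [dist_comm] at h2
      linarith
    · exact ball_subset_ball (hηε.trans (by linarith)) (hseg hz)
  · -- Case B: a boundary point `a = boundary θ` within `η` of `x`
    push Not at hfar
    obtain ⟨a, haf, hxa⟩ := hfar
    obtain ⟨θ, rfl⟩ : ∃ θ, D.boundary θ = a := by
      rw [← D.range_boundary] at haf; exact haf
    set L₂ : Set ℂ := D.boundary '' Icc (θ + τ) (θ + 1 - τ) with hL₂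
    set A : Set ℂ := frontier D.carrier with hA
    set B : Set ℂ := sphere (D.boundary θ) (ε / 2) ∪ L₂ with hB
    have hAc : IsCompact A :=
      Metric.isCompact_of_isClosed_isBounded isClosed_frontier
        (D.isBounded.closure.subset frontier_subset_closure)
    have hL₂c : IsCompact L₂ := isCompact_Icc.image D.continuous_boundary
    have hBc : IsCompact B := (isCompact_sphere _ _).union hL₂c
    have hL₂A : L₂ ⊆ A := by
      rintro _ ⟨φ, -, rfl⟩; exact D.boundary_mem_frontier φ
    have hL₂far : ∀ q ∈ L₂, m ≤ dist (D.boundary θ) q := by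
      rintro _ ⟨φ, hφ, rfl⟩
      exact hmsep θ φ (by linarith [hφ.1]) (by linarith [hφ.2])
    have hsegnear : ∀ z ∈ segment ℝ x y, dist z (D.boundary θ) < 2 * η := fun z hz =>
      calc dist z (D.boundary θ) ≤ dist z x + dist x (D.boundary θ) := dist_triangle _ _ _
        _ < η + η := add_lt_add (hseg hz) hxa
        _ = 2 * η := by ring
    have hAB : A ∩ B = L₂ := by
      refine Subset.antisymm ?_ fun z hz => ⟨hL₂A hz, Or.inr hz⟩
      rintro z ⟨hzA, hzB⟩
      rcases hzB with hzS | hzL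
      · rw [hA, ← D.range_boundary] at hzA
        obtain ⟨φ₀, rfl⟩ := hzA
        obtain ⟨φ, hφ, hφeq⟩ := D.periodic_boundary.exists_mem_Ico one_pos φ₀ θ
        rw [hφeq] at hzS ⊢
        have hdist : dist (D.boundary φ) (D.boundary θ) = ε / 2 := mem_sphere.1 hzS
        refine ⟨φ, ⟨?_, ?_⟩, rfl⟩
        · by_contra hlt
          push Not at hlt
          have := hτε θ φ (by rw [abs_le]; constructor <;> linarith [hφ.1])
          rw [dist_comm] at this
          linarith
        · by_contra hlt
          push Not at hlt
          have := hτε (θ + 1) φ (by rw [abs_le]; constructor <;> linarith [hφ.2])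
          rw [D.periodic_boundary θ, dist_comm] at this
          linarith
      · exact hzL
    have hABpre : IsPreconnected (A ∩ B) := by
      rw [hAB, hL₂]
      exact (isPreconnected_Icc.image _ D.continuous_boundary.continuousOn)
    -- not separated by `A` (both exterior) nor by `B` (the segment)
    have hSA : ∃ S ⊆ Aᶜ, IsPreconnected S ∧ x ∈ S ∧ y ∈ S :=
      ⟨(closure D.carrier)ᶜ, fun z hz hzf => Set.disjoint_left.1 D.disjoint_exterior_frontier hz hzf,
        D.isConnected_exterior.isPreconnected, hx, hy⟩
    have hSB : ∃ S ⊆ Bᶜ, IsPreconnected S ∧ x ∈ S ∧ y ∈ S := by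
      refine ⟨segment ℝ x y, fun z hz hzB => ?_, (convex_segment x y).isPreconnected,
        left_mem_segment ℝ x y, right_mem_segment ℝ x y⟩
      have hz2 := hsegnear z hz
      rcases hzB with hzS | hzL
      · have := mem_sphere.1 hzS
        linarith
      · have := hL₂far z hzL
        rw [dist_comm] at hz2
        linarith
    obtain ⟨S, hS, hSpre, hxS, hyS⟩ :=
      Literature.Topology.PlaneTopology.janiszewski' hAc hBc hABpre hSA hSB
    have hSE : S ⊆ (closure D.carrier)ᶜ :=
      D.subset_exterior_of_isPreconnected hSpre
        (Set.disjoint_left.2 fun z hz hzf => hS hz (Or.inl hzf)) ⟨x, hxS, hx⟩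
    have hSball : S ⊆ ball (D.boundary θ) (ε / 2) :=
      subset_ball_of_isPreconnected hSpre
        (Set.disjoint_left.2 fun z hz hzs => hS hz (Or.inr (Or.inl hzs)))
        ⟨x, hxS, mem_ball.2 (hxa.trans_le (hηε.trans (by linarith)))⟩
    refine ⟨S, fun z hz => ⟨hSE hz, mem_ball.2 ?_⟩, hSpre, hxS, hyS⟩
    calc dist z x ≤ dist z (D.boundary θ) + dist (D.boundary θ) x := dist_triangle _ _ _
      _ < ε / 2 + η := add_lt_add (mem_ball.1 (hSball hz)) (by rwa [dist_comm])
      _ ≤ ε := by linarith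

/-- **Path form.** For `ε > 0` there is `η > 0` such that any two exterior points at distance
`< η` are joined by a path in `(closure D)ᶜ ∩ ball x ε` (the connected set of
`exterior_uniformlyLocallyConnected` lies in one component of this open set, and open connected
subsets of the plane are path connected). [cite: Newman1939, Ch. VI §14 Thm. 14·1 p. 161] -/
theorem exterior_joinedIn_of_dist_lt {ε : ℝ} (hε : 0 < ε) :
    ∃ η > 0, ∀ x ∈ (closure D.carrier)ᶜ, ∀ y ∈ (closure D.carrier)ᶜ, dist x y < η →
      JoinedIn ((closure D.carrier)ᶜ ∩ ball x ε) x y := by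
  obtain ⟨η, hη, h⟩ := D.exterior_uniformlyLocallyConnected hε
  refine ⟨η, hη, fun x hx y hy hxy => ?_⟩
  obtain ⟨S, hS, hSpre, hxS, hyS⟩ := h x hx y hy hxy
  set U : Set ℂ := (closure D.carrier)ᶜ ∩ ball x ε with hU
  have hUo : IsOpen U := D.isOpen_exterior.inter isOpen_ball
  have hyC : y ∈ connectedComponentIn U x := hSpre.subset_connectedComponentIn hxS hS hyS
  have hxU : x ∈ U := hS hxS
  have hCo : IsOpen (connectedComponentIn U x) := hUo.connectedComponentIn
  have hCpath : IsPathConnected (connectedComponentIn U x) :=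
    (hCo.isConnected_iff_isPathConnected).1 (isConnected_connectedComponentIn_iff.2 hxU)
  exact (hCpath.joinedIn x (mem_connectedComponentIn hxU) y hyC).mono
    (connectedComponentIn_subset U x)

end Literature.Probability.RandomPlanarGeometry.JordanDomain
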